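import Literature.MathematicalPhysics.QuantumFieldTheory.Balaban1983to89.B6Ineq2142KLevelV1L0
import Literature.MathematicalPhysics.QuantumFieldTheory.Balaban1983to89.B6Ineq2148TwoScaleV1
import Literature.MathematicalPhysics.QuantumFieldTheory.Balaban1983to89.B6Prop23MultiLevelTorusL0
import HarnessLib
import Literature.MathematicalPhysics.QuantumFieldTheory.Balaban1983to89.B6Cover236MultiLevelBlocksL0
import Literature.MathematicalPhysics.QuantumFieldTheory.Balaban1983to89.B6Geom246MultiLevelBoxL0
import Literature.MathematicalPhysics.QuantumFieldTheory.Balaban1983to89.B6Geom246MultiLevelTorusL0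
import Literature.MathematicalPhysics.QuantumFieldTheory.Balaban1983to89.B6GlobalChartV1L0
import Literature.MathematicalPhysics.QuantumFieldTheory.Balaban1983to89.B6MultiLevelBoxOperatorL0
import Literature.MathematicalPhysics.QuantumFieldTheory.Balaban1983to89.B6MultiLevelTorusOperatorL0

/-!
# `Balaban1983to89.B6Prop27KLevelV1L0` — LEVEL-0 TWIN (programme G-F3′-L0, director-ym LINE №27 / UV3-NODE §24.5; plan `lit-balaban-r03/G-F3L0-PLAN.md`) of `B6Prop27KLevelV1`:
the same declarations, SAME NAMES AND STATEMENTS, for nested families WITH print's region `Λ₀ = T ∖ Ω₁` ADMITTED (structures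
`B6MultiLevelBoxOperatorL0.Domains` / `B6MultiLevelTorusOperatorL0.TDomains`: levels `0, …, k`, the level-`0` block a single site, `Q′₀ = id`,
finite weight `a₀` — print p.225 (2.14) «Σ_{j=0}^k … (Q′₀λ)(x) = λ(x), x ∈ Λ₀», p.229 «taking a sequence (2.1) … smallest possible domains B^j(Λ_j),
and considering the operator Δ_a defined by (2.19), (2.20) for this sequence»).  Every `D`-free object is the lineage's, consumed BY NAME; no existing
module is touched; no fact is minted.  Unit `lit-balaban-r03` (B6 fold owner; port r03 gen 36, filed by the successor seat r03 gen 37 —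
declarations unchanged from the g36 staged text); referee ref-4.  THE TWIN'S DOCUMENTATION FOLLOWS
VERBATIM (its «levels 1 … k» / «Ω₁ = X» sentences describe the twin; here `j` runs from `0` and `Ω₁` may be a proper subset).

# `Balaban1983to89.B6Prop27KLevelV1` — T. Bałaban, *Propagators and renormalization transformations for lattice gauge theories. II*,
Comm. Math. Phys. **96** (1984) 223–250 [Balaban1984PropagatorsII], **Proposition 2.7 (2.149) p. 249 AT k LEVELS for the genuine
`(QGQ*)⁻¹ = EE (domT hN D hk)`** on ROUTE V's V1 torus, by the global road of [3] Sect. 5 («we will follow rather closely the arguments given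
for [Q′G′²Q′*]», p. 248): (2.142) (`B6Ineq2142KLevelV1L0.ineq2142_kLevel`) + the global level-weighted coercivity (2.147) (a DISPLAYED HYPOTHESIS
of this file, to be discharged by `B6QGQCoerciveKLevelV1`) ⇒ [3] (5.6) for the conjugated operator `Λ⁻¹(QGQ*)Λ⁻¹` on `L²` of ALL index bonds
⇒ (5.7) (`B6Ineq2148TwoScaleV1.inverse_entry_decay` = `B4Sect5Torus.inv_decay` at operator level; profile = Lemma 2.1 on the torus) ⇒ (2.149).

HONEST FRAMING (programme rule): statement-level skeleton of published theorems with citation tags; proofs where landed; nothing here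
is a claim about the Yang–Mills mass gap.  r03 gen 23, ROUTE W file W3 (B6-CLOSURE §5 item 17).

## WHAT THIS FILE CERTIFIES (kernel-checked, sorry-free, standard axioms; lattice units, `D = d + 1`, `L = ℓ + 1`)

* §1 THE CONJUGATION: weights `wt i = Λ_i² = (L^{j(i)}/c_f)²·L^{−j(i)D}` (the size of `(QGQ*)(i,i)` in the flat basis, (2.142)), `lam i = Λ_i`,
  the diagonal operators `Lop`/`Linv` (`aE` of [`B6SectAOperatorsV1`]), the conjugated operator **`Tc = Λ⁻¹(QGQ*)Λ⁻¹`** (`Tc_symm`, entries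
  `inner_single_Tc : ⟪e_i, Tc e_{i′}⟫ = Λ_i⁻¹Λ_{i′}⁻¹X(i,i′)`), **`Tc_entry_le`**: (2.142) in BOTH orders ⇒ `|⟪e_i, Tc e_{i′}⟫| ≤ A′e^{−δ d_T(β i, β i′)}`
  (`X(i,i′)² ≤ bound(i,i′)·bound(i′,i) = A′²Λ_i²Λ_{i′}²e^{−2δd}` — no level comparison needed), **`Tc_coercive`**: the level-weighted (2.147)
  `γΣΛ_i²v_i² ≤ ⟪Q*v, GQ*v⟫` ⇒ `γ‖x‖² ≤ ⟪x, Tc x⟫`, `isUnit_Tc`;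
* §2 THE INDEX-BOND PSEUDO-DISTANCE `rho i i′ = d_T(β i, β i′)` (`rho_isPseudoDist`), the fibre count **`card_fiber_beta_le`** (at most `2D` index
  bonds share a carrier block) and **`rho_sumBound`** (profile `2D·K`);
* §3 THE INVERSE: **`EE_eq_conj`** (`(QGQ*)⁻¹ = Λ⁻¹·(Tc)⁻¹·Λ⁻¹`, by uniqueness of the inverse [`B6SectAVectorModelV1.comp_EE`]),
  `inner_single_EE` (`⟪e_i, (QGQ*)⁻¹e_{i′}⟫ = Λ_i⁻¹Λ_{i′}⁻¹⟪e_i, Tc⁻¹e_{i′}⟫`);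
* §4 **`prop27_kLevel_of_coercive`**: for a torus family with `M_h ≥ 1`, `P′ ≥ 1`, `k ≥ 1`, the Lemma-2.1 profile hypothesis `Ineq261With c (geomT D) δ₀ (1/16)`,
  (2.142) with constants `A′, δ` and (2.147) with constant `γ`: for ALL index bonds
  `|⟪e_i, (QGQ*)⁻¹e_{i′}⟫| ≤ (2/γ)·(Λ_iΛ_{i′})⁻¹·e^{−δ₄ d_T(β i, β i′)}`, `δ₄ = rate(2D·K_prof, γ/A′, 1, δ)`, `(Λ_iΛ_{i′})⁻¹ = c_f²(L^{j(i)}L^{j(i′)})^{(D−2)/2}`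
  — print's `O(1)(L^jη)^{d−2}η^{−2}e^{−δ₄d(b,b′)}` with the two length factors shared symmetrically («the choice of factors is again arbitrary»,
  p. 238); and **`prop27_kLevel`**: the same with (2.142) DISCHARGED by `ineq2142_kLevel` (ROUTE V setting: `k ≥ 2`, `M_h = L^a ≥ 8`, `M₂ ≤ L·M_h`,
  `R ≥ 2L²`, `P′ ≥ 5`, `L ≥ 5`, `Placed`, weights in the band (2.16)), the coercivity (2.147) remaining the ONE displayed hypothesis.

## HONEST SCOPE

(1) The global level-weighted (2.147) `γΣ_iΛ_i²v_i² ≤ ⟪Q*v, GQ*v⟫` is a HYPOTHESIS here (print proves (2.147) per cube, p. 248–249; the global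
form is what the [3]-Sect.-5 road consumes, exactly as p21's `B6QGGQCoerciveMultiLevelTorus` serves Prop. 2.3); its discharge is ROUTE W file W1.
(2) `d(b,b′)` := p21's torus graph distance (2.46) between the carrier blocks `β i = B^j(base i) ∈ 𝔅`.  (3) The profile of Lemma 2.1 enters as
p21's `Ineq261With … (1/16)` hypothesis in §4's first theorem and is discharged («for M large enough») in `prop27_kLevel` by `lemma21_torus`
under the threshold `N₁ + 1 ≤ R·L·M_h`, as in `B6Prop23MultiLevelTorusL0.prop23_multiLevelTorus`.  (4) Not claimed: the verbatim `B6.Prop27Printed`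
(its `GFamily` slots stay schematic), Cor. 2.8, the one-sided length factor `(L^{j}η)^{d−2}` for `j′ ≫ j` (needs the level-separation absorption (2.60)).
-/

namespace Literature.MathematicalPhysics.QuantumFieldTheory.Balaban1983to89.B6Prop27KLevelV1L0

open LatticeFieldCalculus
open scoped InnerProductSpace
open B5Eq118OneStroke (iterBlockOf)
open B6LowerBound2153Torus (rep)
open B5Eq117TorusCarriers (Mk)
open B6MultiLevelBoxOperator (N0)
open B6MultiLevelBoxOperatorL0 (Domains)
open B6MultiLevelTorusOperatorL0 (TDomains)
open B6Geom246MultiLevelBoxL0 (bset blkOf blkOf_val)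
open B6Geom246MultiLevelTorusL0 (geomT bondT lemma21_torus)
open B6Lemma21Repaired (Ineq261With)
open B6Ineq261LevelGap (K261 K261_nonneg)
open B6Ineq281MultiLevelBox (Kprof)
open B6GlobalChartV1 (PV toBox blk_toBox)
open B6GlobalChartV1L0 (domT blkV1)
open B6RandomWalk (delta3)
open B6SectAOperatorsV1 (QE QsE aE aE_apply inner_aE_left BondIdx BondIdxSpace inner_QsE_left)
open B6SectAVectorModelV1 (GE EE inner_GE_left comp_EE EE_comp)
open B6Prop23MultiLevelTorusL0 (isPseudoDist_distT sumBound_torus)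
open B4Sect5Torus (IsPseudoDist SumBound Hyp56 rate rate_pos)
open B6Ineq2148TwoScaleV1 (inverse_entry_decay)
open B6Ineq2142KLevelV1 (one_le_lvl shift_injective)
open B6Ineq2142KLevelV1L0 (lvl lvl_le_mK base baseSite iterBlockOf_baseSite β beta_level X X_eq_inner X_symm)
open B6CubeWindowV1 (Placed GlobalBand)
open B6Cover236MultiLevelBlocksL0 (cubes)

noncomputable section

variable {d ℓ m K : ℕ} {hd : 1 ≤ d + 1} {hL : Odd (ℓ + 1) ∧ 1 < ℓ + 1}
variable {Mh k R : ℕ} {P' : Fin (d + 1) → ℕ}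

/-! ## §1  The conjugation `Λ⁻¹(QGQ*)Λ⁻¹` -/

section Conj

variable (hN : ∀ μ, N0 ℓ Mh k P' μ = (PV d ℓ m K hd hL).sitesPerDir 0) (D : TDomains d ℓ Mh k P' R) (hk : k ≤ m + K)

/-- **`Λ_i²`** = the size `(L^{j}/c_f)²·L^{−jD}` of the diagonal of `QGQ*` in the flat basis ((2.142) at `i = i′`).
[cite: Balaban1984PropagatorsII, (2.142) p.248, (2.81) p.237 (the conjugation `ΛAΛ` of [3] Sect. 5)] -/
def wt (cf : ℝ) (i : BondIdx (domT hN D hk)) : ℝ :=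
  ((((ℓ + 1 : ℕ) : ℝ)) ^ (lvl hN D hk i) / cf) ^ 2 * ((((ℓ + 1 : ℕ) : ℝ) ^ (d + 1)) ^ (lvl hN D hk i))⁻¹

/-- `Λ_i² > 0`. [cite: Balaban1984PropagatorsII, (2.81) p.237, bookkeeping] -/
theorem wt_pos {cf : ℝ} (hcf : cf ≠ 0) (i : BondIdx (domT hN D hk)) : 0 < wt hN D hk cf i := by
  unfold wt
  have hne : (((ℓ + 1 : ℕ) : ℝ)) ^ (lvl hN D hk i) / cf ≠ 0 := div_ne_zero (pow_ne_zero _ (by positivity)) hcf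
  positivity

/-- **`Λ_i`**. [cite: Balaban1984PropagatorsII, (2.81) p.237] -/
def lam (cf : ℝ) (i : BondIdx (domT hN D hk)) : ℝ := Real.sqrt (wt hN D hk cf i)

/-- `Λ_i > 0`. [cite: Balaban1984PropagatorsII, (2.81) p.237, bookkeeping] -/
theorem lam_pos {cf : ℝ} (hcf : cf ≠ 0) (i : BondIdx (domT hN D hk)) : 0 < lam hN D hk cf i :=
  Real.sqrt_pos.2 (wt_pos hN D hk hcf i)

/-- `Λ_i² = wt`. [cite: Balaban1984PropagatorsII, (2.81) p.237, bookkeeping] -/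
theorem lam_sq {cf : ℝ} (hcf : cf ≠ 0) (i : BondIdx (domT hN D hk)) : lam hN D hk cf i ^ 2 = wt hN D hk cf i :=
  Real.sq_sqrt (wt_pos hN D hk hcf i).le

/-- **`Λ⁻¹`** as a diagonal operator. [cite: Balaban1984PropagatorsII, (2.81) p.237] -/
def Linv (cf : ℝ) : BondIdxSpace (domT hN D hk) →ₗ[ℝ] BondIdxSpace (domT hN D hk) :=
  aE (domT hN D hk) fun i => (lam hN D hk cf i)⁻¹

/-- **`Λ`** as a diagonal operator. [cite: Balaban1984PropagatorsII, (2.81) p.237] -/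
def Lop (cf : ℝ) : BondIdxSpace (domT hN D hk) →ₗ[ℝ] BondIdxSpace (domT hN D hk) :=
  aE (domT hN D hk) fun i => lam hN D hk cf i

/-- `Λ⁻¹Λ = 1`. [cite: Balaban1984PropagatorsII, (2.81) p.237, bookkeeping] -/
theorem Linv_comp_Lop {cf : ℝ} (hcf : cf ≠ 0) : Linv hN D hk cf ∘ₗ Lop hN D hk cf = LinearMap.id := by
  refine LinearMap.ext fun v => PiLp.ext fun i => ?_
  rw [LinearMap.comp_apply, Linv, Lop, aE_apply, aE_apply, LinearMap.id_apply, ← mul_assoc,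
    inv_mul_cancel₀ (lam_pos hN D hk hcf i).ne', one_mul]

/-- `ΛΛ⁻¹ = 1`. [cite: Balaban1984PropagatorsII, (2.81) p.237, bookkeeping] -/
theorem Lop_comp_Linv {cf : ℝ} (hcf : cf ≠ 0) : Lop hN D hk cf ∘ₗ Linv hN D hk cf = LinearMap.id := by
  refine LinearMap.ext fun v => PiLp.ext fun i => ?_
  rw [LinearMap.comp_apply, Linv, Lop, aE_apply, aE_apply, LinearMap.id_apply, ← mul_assoc,
    mul_inv_cancel₀ (lam_pos hN D hk hcf i).ne', one_mul]

/-- a diagonal operator on a basis vector: `a·e_x = a(x)e_x`. [cite: Balaban1984PropagatorsII, (2.7) p.224, dictionary] -/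
theorem aE_single (c : BondIdx (B6GlobalChartV1L0.domT hN D hk) → ℝ) (x : BondIdx (domT hN D hk)) :
    aE (domT hN D hk) c (EuclideanSpace.single x (1 : ℝ)) = c x • EuclideanSpace.single x (1 : ℝ) := by
  refine PiLp.ext fun i => ?_
  rw [aE_apply, PiLp.smul_apply, smul_eq_mul]
  by_cases h : i = x
  · subst h; rfl
  · have h0 : (EuclideanSpace.single x (1 : ℝ)) i = 0 := by
      rw [show (EuclideanSpace.single x (1 : ℝ)) i = if i = x then 1 else 0 from PiLp.single_apply _ _ _ _ _, if_neg h]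
    rw [h0, mul_zero, mul_zero]

/-- **the sandwich formula**: `⟪e_x, a·S·a e_{x′}⟫ = a(x)a(x′)⟪e_x, S e_{x′}⟫` for a diagonal `a`. [cite: Balaban1984PropagatorsII, (2.81) p.237 («A_Λ = ΛAΛ»)] -/
theorem inner_single_sandwich (c : BondIdx (B6GlobalChartV1L0.domT hN D hk) → ℝ) (S : BondIdxSpace (domT hN D hk) →ₗ[ℝ] BondIdxSpace (domT hN D hk))
    (x x' : BondIdx (domT hN D hk)) :
    ⟪EuclideanSpace.single x (1 : ℝ), aE (domT hN D hk) c (S (aE (domT hN D hk) c (EuclideanSpace.single x' (1 : ℝ))))⟫_ℝ =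
      c x * c x' * ⟪EuclideanSpace.single x (1 : ℝ), S (EuclideanSpace.single x' (1 : ℝ))⟫_ℝ := by
  rw [← inner_aE_left, aE_single, aE_single, map_smul, real_inner_smul_left, real_inner_smul_right, mul_assoc]

variable {cf : ℝ} (hcf : cf ≠ 0) {w : BondIdx (domT hN D hk) → ℝ} (hw : ∀ i, 0 < w i)

/-- `QGQ*` is symmetric. [cite: Balaban1984PropagatorsII, (2.35) p.228] -/
theorem qgq_symm (a b : BondIdxSpace (B6GlobalChartV1L0.domT hN D hk)) :
    ⟪QE (domT hN D hk) (GE (domT hN D hk) hcf hw (QsE (domT hN D hk) a)), b⟫_ℝ =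
      ⟪a, QE (domT hN D hk) (GE (domT hN D hk) hcf hw (QsE (domT hN D hk) b))⟫_ℝ := by
  rw [real_inner_comm, ← inner_QsE_left, ← inner_GE_left, real_inner_comm, inner_QsE_left]

/-- **THE CONJUGATED OPERATOR `Tc = Λ⁻¹(QGQ*)Λ⁻¹`** on `L²` of all index bonds. [cite: Balaban1984PropagatorsII, (2.81) p.237, p.248] -/
def Tc : BondIdxSpace (domT hN D hk) →ₗ[ℝ] BondIdxSpace (domT hN D hk) :=
  Linv hN D hk cf ∘ₗ (QE (domT hN D hk) ∘ₗ GE (domT hN D hk) hcf hw ∘ₗ QsE (domT hN D hk)) ∘ₗ Linv hN D hk cf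

/-- unfolding. [cite: Balaban1984PropagatorsII, (2.81) p.237] -/
theorem Tc_apply (v : BondIdxSpace (domT hN D hk)) :
    Tc hN D hk hcf hw v = Linv hN D hk cf (QE (domT hN D hk) (GE (domT hN D hk) hcf hw (QsE (domT hN D hk) (Linv hN D hk cf v)))) := rfl

/-- `Tc` is symmetric. [cite: Balaban1984PropagatorsII, (2.81) p.237; Balaban1983RegularityDecay, (5.6) p.594] -/
theorem Tc_symm (a b : BondIdxSpace (domT hN D hk)) : ⟪Tc hN D hk hcf hw a, b⟫_ℝ = ⟪a, Tc hN D hk hcf hw b⟫_ℝ := by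
  rw [Tc_apply, Tc_apply, Linv, inner_aE_left, qgq_symm, ← inner_aE_left]

/-- **the entries of `Tc`**: `⟪e_i, Tc e_{i′}⟫ = Λ_i⁻¹Λ_{i′}⁻¹·X(i, i′)`. [cite: Balaban1984PropagatorsII, (2.81) p.237] -/
theorem inner_single_Tc (x x' : BondIdx (domT hN D hk)) :
    ⟪EuclideanSpace.single x (1 : ℝ), Tc hN D hk hcf hw (EuclideanSpace.single x' (1 : ℝ))⟫_ℝ =
      (lam hN D hk cf x)⁻¹ * (lam hN D hk cf x')⁻¹ * X hN D hk hcf hw x x' := by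
  rw [Tc_apply, Linv, X_eq_inner]
  exact inner_single_sandwich hN D hk _ (QE (domT hN D hk) ∘ₗ GE (domT hN D hk) hcf hw ∘ₗ QsE (domT hN D hk)) x x'

/-- **(5.6) ENTRY BOUND FOR `Tc` FROM (2.142) IN BOTH ORDERS**: `|⟪e_i, Tc e_{i′}⟫| ≤ A′e^{−δρ(i,i′)}` whenever
`|X(i,i′)| ≤ A′(L^{j(i)}/c_f)²L^{−j(i′)D}e^{−δρ(i,i′)}` for all `i, i′` and `ρ` is symmetric (`X(i,i′)² ≤ A′²Λ_i²Λ_{i′}²e^{−2δρ}`).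
[cite: Balaban1984PropagatorsII, (2.142) p.248, (2.81) p.237; Balaban1983RegularityDecay, (5.6) p.594] -/
theorem Tc_entry_le {A' δ : ℝ} (hA : 0 ≤ A') {ρ : BondIdx (domT hN D hk) → BondIdx (domT hN D hk) → ℝ} (hρ : ∀ i i', ρ i i' = ρ i' i)
    (h2142 : ∀ i i' : BondIdx (domT hN D hk), |X hN D hk hcf hw i i'| ≤
      A' * ((((ℓ + 1 : ℕ) : ℝ)) ^ (lvl hN D hk i) / cf) ^ 2 * ((((ℓ + 1 : ℕ) : ℝ) ^ (d + 1)) ^ (lvl hN D hk i'))⁻¹ * Real.exp (-(δ * ρ i i')))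
    (x x' : BondIdx (domT hN D hk)) :
    |⟪EuclideanSpace.single x (1 : ℝ), Tc hN D hk hcf hw (EuclideanSpace.single x' (1 : ℝ))⟫_ℝ| ≤ A' * Real.exp (-(δ * ρ x x')) := by
  rw [inner_single_Tc]
  have hl := lam_pos hN D hk hcf x
  have hl' := lam_pos hN D hk hcf x'
  -- `X(x,x′)² ≤ A′² wt(x) wt(x′) e^{−2δρ}`
  have h1 := h2142 x x'
  have h2 := h2142 x' x
  rw [← X_symm hN D hk hcf hw x x', hρ x' x] at h2
  have hsq : (X hN D hk hcf hw x x') ^ 2 ≤ (A' * Real.exp (-(δ * ρ x x'))) ^ 2 * (wt hN D hk cf x * wt hN D hk cf x') := by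
    have h0 : 0 ≤ |X hN D hk hcf hw x x'| := abs_nonneg _
    have := mul_le_mul h1 h2 h0 (le_trans h0 h1)
    rw [← sq_abs, pow_two]
    refine this.trans (le_of_eq ?_)
    unfold wt; ring
  have htarget : 0 ≤ A' * Real.exp (-(δ * ρ x x')) := by positivity
  -- divide by `Λ_xΛ_{x′}`
  have hprod : ((lam hN D hk cf x)⁻¹ * (lam hN D hk cf x')⁻¹ * X hN D hk hcf hw x x') ^ 2 ≤ (A' * Real.exp (-(δ * ρ x x'))) ^ 2 := by
    rw [mul_pow, mul_pow, inv_pow, inv_pow, lam_sq hN D hk hcf, lam_sq hN D hk hcf]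
    have hw1 := wt_pos hN D hk hcf x
    have hw2 := wt_pos hN D hk hcf x'
    calc (wt hN D hk cf x)⁻¹ * (wt hN D hk cf x')⁻¹ * X hN D hk hcf hw x x' ^ 2
        ≤ (wt hN D hk cf x)⁻¹ * (wt hN D hk cf x')⁻¹ * ((A' * Real.exp (-(δ * ρ x x'))) ^ 2 * (wt hN D hk cf x * wt hN D hk cf x')) :=
          mul_le_mul_of_nonneg_left hsq (by positivity)
      _ = (A' * Real.exp (-(δ * ρ x x'))) ^ 2 := by field_simp
  exact abs_le.2 (abs_le_of_sq_le_sq' hprod htarget)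

/-- **(5.6) COERCIVITY OF `Tc` FROM THE LEVEL-WEIGHTED (2.147)**: `γΣ_iΛ_i²v_i² ≤ ⟪Q*v, GQ*v⟫` for all `v` ⇒ `γ‖x‖² ≤ ⟪x, Tc x⟫`.
[cite: Balaban1984PropagatorsII, (2.147) p.248, (2.81) p.237; Balaban1983RegularityDecay, (5.6) p.594] -/
theorem Tc_coercive {γ : ℝ}
    (hγ : ∀ v : BondIdxSpace (domT hN D hk), γ * ∑ i, wt hN D hk cf i * v i ^ 2 ≤
      ⟪QsE (domT hN D hk) v, GE (domT hN D hk) hcf hw (QsE (domT hN D hk) v)⟫_ℝ)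
    (x : BondIdxSpace (domT hN D hk)) : γ * ‖x‖ ^ 2 ≤ ⟪x, Tc hN D hk hcf hw x⟫_ℝ := by
  rw [Tc_apply, Linv, ← inner_aE_left, ← inner_QsE_left]
  refine le_trans (le_of_eq ?_) (hγ _)
  rw [EuclideanSpace.norm_eq, Real.sq_sqrt (Finset.sum_nonneg fun i _ => by positivity)]
  congr 1
  refine Finset.sum_congr rfl fun i _ => ?_
  rw [aE_apply, Real.norm_eq_abs, sq_abs, mul_pow, inv_pow, lam_sq hN D hk hcf, ← mul_assoc,
    mul_inv_cancel₀ (wt_pos hN D hk hcf i).ne', one_mul]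

/-- `Tc` is a unit (coercivity with `γ > 0`). [cite: Balaban1984PropagatorsII, p.228 («an inverse is a well-defined … operator»); Balaban1983RegularityDecay, Sect. 5 p.594] -/
theorem isUnit_Tc {γ : ℝ} (hγ0 : 0 < γ)
    (hγ : ∀ v : BondIdxSpace (domT hN D hk), γ * ∑ i, wt hN D hk cf i * v i ^ 2 ≤
      ⟪QsE (domT hN D hk) v, GE (domT hN D hk) hcf hw (QsE (domT hN D hk) v)⟫_ℝ) :
    IsUnit (Tc hN D hk hcf hw) := by
  refine (LinearMap.isUnit_iff_ker_eq_bot _).2 (LinearMap.ker_eq_bot'.2 fun x hx => ?_)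
  have h := Tc_coercive hN D hk hcf hw hγ x
  rw [hx, inner_zero_right] at h
  have h2 : ‖x‖ ^ 2 ≤ 0 := by
    by_contra hne
    exact absurd h (not_le.2 (mul_pos hγ0 (lt_of_not_ge hne)))
  exact norm_eq_zero.1 (by nlinarith [norm_nonneg x])

end Conj

/-! ## §2  The index-bond pseudo-distance `ρ(i, i′) = d_T(β i, β i′)` and its profile -/

section Rho

variable (hN : ∀ μ, N0 ℓ Mh k P' μ = (PV d ℓ m K hd hL).sitesPerDir 0) (D : TDomains d ℓ Mh k P' R) (hk : k ≤ m + K)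

/-- **`ρ(i, i′) = d_T(β i, β i′)`**: print's `d(b, b′)` between the carrier blocks. [cite: Balaban1984PropagatorsII, (2.46) p.231, (2.149) p.249] -/
def rho (i i' : BondIdx (domT hN D hk)) : ℝ := (geomT D).dist (β hN D hk i) (β hN D hk i')

/-- `ρ` is a pseudo-distance. [cite: Balaban1984PropagatorsII, (2.46) p.231, (2.54) p.233] -/
theorem rho_isPseudoDist (hMh : 1 ≤ Mh) (hP : ∀ μ, 1 ≤ P' μ) : IsPseudoDist (rho hN D hk) :=
  (isPseudoDist_distT D hMh hP).comp (β hN D hk)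

/-- `rep` is injective: a site of `T^{(j)}` is determined by its labels. [cite: Balaban1984PropagatorsI, (1.7) p.18, dictionary] -/
private theorem rep_injective (j : ℕ) : Function.Injective (rep (Mk (PV d ℓ m K hd hL) j) : Site (PV d ℓ m K hd hL) j → Fin (d + 1) → ℤ) := by
  intro y y' h
  funext μ
  have hμ := congrFun h μ
  simp only [rep, Nat.cast_inj] at hμ
  exact ZMod.val_injective _ hμ

/-- the carrier block determines the level and the base end-point. [cite: Balaban1984PropagatorsII, (2.45) p.231, bookkeeping] -/
theorem beta_val (i : BondIdx (domT hN D hk)) :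
    ((β hN D hk i : ↥(bset D.toDomains)) : ℕ × (Fin (d + 1) → ℤ)) =
      (lvl hN D hk i, rep (Mk (PV d ℓ m K hd hL) (lvl hN D hk i)) (base hN D hk i)) := by
  have hlev := beta_level hN D hk i
  unfold β at hlev ⊢
  rw [blkOf_val] at hlev ⊢
  simp only at hlev
  rw [hlev, blk_toBox hN (lvl_le_mK hN D hk i), iterBlockOf_baseSite]

/-- **AT MOST `2D` INDEX BONDS SHARE A CARRIER BLOCK** (`β i` determines `j(i)` and `base i`; the bond is `⟨base, μ⟩` or `⟨base − e_μ, μ⟩`).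
[cite: Balaban1984PropagatorsII, (2.45) p.231, (2.6)/(2.20) p.224–226 (the index set), bookkeeping] -/
theorem card_fiber_beta_le (y : ↥(bset D.toDomains)) :
    (Finset.univ.filter fun i : BondIdx (domT hN D hk) => β hN D hk i = y).card ≤ 2 * (d + 1) := by
  classical
  -- the code `(direction, is the source the base?)`
  set code : BondIdx (domT hN D hk) → Fin (d + 1) × Bool := fun i => (i.1.2.dir, decide (i.1.2.src ∈ (domT hN D hk).Om i.1.1)) with hcode
  have hinj : Set.InjOn code ↑(Finset.univ.filter fun i : BondIdx (domT hN D hk) => β hN D hk i = y) := by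
    intro i hi i' hi' hc
    rw [Finset.coe_filter] at hi hi'
    have hb : β hN D hk i = β hN D hk i' := hi.2.trans hi'.2.symm
    have hv := congrArg (fun z : ↥(bset D.toDomains) => (z : ℕ × (Fin (d + 1) → ℤ))) hb
    rw [beta_val hN D hk, beta_val hN D hk, Prod.mk.injEq] at hv
    obtain ⟨hlv, hrep⟩ := hv
    simp only [hcode, Prod.mk.injEq, decide_eq_decide] at hc
    obtain ⟨hdir, hflag⟩ := hc
    -- destructure and align the levels
    obtain ⟨⟨j, b⟩, hbL⟩ := i
    obtain ⟨⟨j', b'⟩, hbL'⟩ := i'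
    have hjj : j = j' := Fin.ext (by simpa [lvl] using hlv)
    subst hjj
    simp only at hdir hflag hrep
    have hbase : base hN D hk ⟨⟨j, b⟩, hbL⟩ = base hN D hk ⟨⟨j, b'⟩, hbL'⟩ := rep_injective j (by
      have := hrep
      simpa [lvl] using this)
    -- the bonds coincide
    have hbb : b = b' := by
      unfold base at hbase
      simp only at hbase
      by_cases hs : b.src ∈ (domT hN D hk).Om j
      · have hs' : b'.src ∈ (domT hN D hk).Om j := hflag.1 hs
        rw [if_pos hs, if_pos hs'] at hbase
        cases b; cases b'; simp only at hbase hdir; simp [hbase, hdir]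
      · have hs' : b'.src ∉ (domT hN D hk).Om j := fun h => hs (hflag.2 h)
        rw [if_neg hs, if_neg hs'] at hbase
        have hsrc : b.src = b'.src := by
          have h1 : b.tgt = b'.tgt := hbase
          unfold PBond.tgt at h1
          rw [hdir] at h1
          exact shift_injective b'.dir h1
        cases b; cases b'; simp only at hsrc hdir; simp [hsrc, hdir]
    subst hbb
    rfl
  have h := Finset.card_le_card_of_injOn code (fun i _ => Finset.mem_univ (code i)) hinj
  refine h.trans (le_of_eq ?_)
  simp [mul_comm]

/-- **THE PROFILE OF `ρ`**: `Σ_{i′} e^{−aρ(i,i′)} ≤ 2D·K(a)` from a block profile `Σ_{y′} e^{−a d_T(y,y′)} ≤ K(a)`.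
[cite: Balaban1984PropagatorsII, Lemma 2.1 (2.61) p.234; Balaban1983RegularityDecay, (5.9) p.595] -/
theorem rho_sumBound {Kp : ℝ → ℝ} (hS : SumBound (fun y y' : ↥(bset D.toDomains) => (geomT D).dist y y') Kp) :
    SumBound (rho hN D hk) fun a => 2 * ((d : ℝ) + 1) * Kp a := by
  classical
  intro a ha i
  show ∑ i', Real.exp (-(a * rho hN D hk i i')) ≤ 2 * ((d : ℝ) + 1) * Kp a
  set g : ↥(bset D.toDomains) → ℝ := fun y' => Real.exp (-(a * (geomT D).dist (β hN D hk i) y')) with hg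
  have hg0 : ∀ y', 0 ≤ g y' := fun y' => (Real.exp_pos _).le
  have h1 : ∑ i', Real.exp (-(a * rho hN D hk i i')) = ∑ i' : BondIdx (domT hN D hk), g (β hN D hk i') := rfl
  rw [h1, Finset.sum_comp]
  calc ∑ y' ∈ Finset.univ.image (β hN D hk), (Finset.univ.filter fun i' => β hN D hk i' = y').card • g y'
      ≤ ∑ y' ∈ Finset.univ.image (β hN D hk), (2 * ((d : ℝ) + 1)) * g y' := Finset.sum_le_sum fun y' _ => by
        rw [nsmul_eq_mul]
        refine mul_le_mul_of_nonneg_right ?_ (hg0 y')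
        exact_mod_cast card_fiber_beta_le hN D hk y'
    _ ≤ ∑ y', (2 * ((d : ℝ) + 1)) * g y' :=
        Finset.sum_le_sum_of_subset_of_nonneg (Finset.subset_univ _) fun y' _ _ => by positivity
    _ = 2 * ((d : ℝ) + 1) * ∑ y', g y' := by rw [Finset.mul_sum]
    _ ≤ 2 * ((d : ℝ) + 1) * Kp a := mul_le_mul_of_nonneg_left (hS a ha _) (by positivity)

end Rho

/-! ## §3  The inverse `(QGQ*)⁻¹ = Λ⁻¹·Tc⁻¹·Λ⁻¹` -/

section Inverse

variable (hN : ∀ μ, N0 ℓ Mh k P' μ = (PV d ℓ m K hd hL).sitesPerDir 0) (D : TDomains d ℓ Mh k P' R) (hk : k ≤ m + K)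
variable {cf : ℝ} (hcf : cf ≠ 0) {w : BondIdx (domT hN D hk) → ℝ} (hw : ∀ i, 0 < w i)

/-- uniqueness of the inverse of `QGQ*`: any left inverse is `EE`. [cite: Balaban1984PropagatorsII, (2.35) p.228] -/
theorem EE_unique (G' : BondIdxSpace (B6GlobalChartV1L0.domT hN D hk) →ₗ[ℝ] BondIdxSpace (domT hN D hk))
    (h : G' ∘ₗ (QE (domT hN D hk) ∘ₗ GE (domT hN D hk) hcf hw ∘ₗ QsE (domT hN D hk)) = LinearMap.id) :
    G' = EE (domT hN D hk) hcf hw := by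
  have h2 := comp_EE (domT hN D hk) hcf hw
  have h3 : G' = G' ∘ₗ ((QE (domT hN D hk) ∘ₗ GE (domT hN D hk) hcf hw ∘ₗ QsE (domT hN D hk)) ∘ₗ EE (domT hN D hk) hcf hw) := by
    rw [h2, LinearMap.comp_id]
  rw [h3, ← LinearMap.comp_assoc, h, LinearMap.id_comp]

/-- **`(QGQ*)⁻¹ = Λ⁻¹·Tc⁻¹·Λ⁻¹`** (the conjugation undone, (2.86)-style). [cite: Balaban1984PropagatorsII, (2.86) p.238, (2.81) p.237, (2.35) p.228] -/
theorem EE_eq_conj (hU : IsUnit (Tc hN D hk hcf hw)) :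
    EE (domT hN D hk) hcf hw = Linv hN D hk cf ∘ₗ Ring.inverse (Tc hN D hk hcf hw) ∘ₗ Linv hN D hk cf := by
  symm
  apply EE_unique
  have hinv : ∀ u, Ring.inverse (Tc hN D hk hcf hw) (Tc hN D hk hcf hw u) = u := fun u => by
    have h1 := Ring.inverse_mul_cancel _ hU
    rw [Module.End.mul_eq_comp, Module.End.one_eq_id] at h1
    exact LinearMap.congr_fun h1 u
  have hLl : ∀ u, Linv hN D hk cf (Lop hN D hk cf u) = u := fun u => LinearMap.congr_fun (Linv_comp_Lop hN D hk hcf) u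
  have hlL : ∀ u, Lop hN D hk cf (Linv hN D hk cf u) = u := fun u => LinearMap.congr_fun (Lop_comp_Linv hN D hk hcf) u
  -- `QGQ* = Λ·Tc·Λ`
  have hq : ∀ v, QE (domT hN D hk) (GE (domT hN D hk) hcf hw (QsE (domT hN D hk) v)) =
      Lop hN D hk cf (Tc hN D hk hcf hw (Lop hN D hk cf v)) := fun v => by
    rw [Tc_apply, hLl, hlL]
  refine LinearMap.ext fun v => ?_
  simp only [LinearMap.comp_apply, LinearMap.id_apply]
  rw [hq, hLl, hinv, hLl]

/-- **the entries of `(QGQ*)⁻¹`**: `⟪e_i, (QGQ*)⁻¹e_{i′}⟫ = Λ_i⁻¹Λ_{i′}⁻¹·⟪e_i, Tc⁻¹e_{i′}⟫`. [cite: Balaban1984PropagatorsII, (2.86) p.238] -/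
theorem inner_single_EE (hU : IsUnit (Tc hN D hk hcf hw)) (x x' : BondIdx (domT hN D hk)) :
    ⟪EuclideanSpace.single x (1 : ℝ), EE (domT hN D hk) hcf hw (EuclideanSpace.single x' (1 : ℝ))⟫_ℝ =
      (lam hN D hk cf x)⁻¹ * (lam hN D hk cf x')⁻¹ *
        ⟪EuclideanSpace.single x (1 : ℝ), Ring.inverse (Tc hN D hk hcf hw) (EuclideanSpace.single x' (1 : ℝ))⟫_ℝ := by
  rw [EE_eq_conj hN D hk hcf hw hU, LinearMap.comp_apply, LinearMap.comp_apply, Linv]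
  exact inner_single_sandwich hN D hk _ _ x x'

end Inverse

/-! ## §4  Proposition 2.7 (2.149) at k levels -/

section Main

variable (hN : ∀ μ, N0 ℓ Mh k P' μ = (PV d ℓ m K hd hL).sitesPerDir 0) (D : TDomains d ℓ Mh k P' R) (hk : k ≤ m + K)
variable {cf : ℝ} (hcf : cf ≠ 0) {w : BondIdx (domT hN D hk) → ℝ} (hw : ∀ i, 0 < w i)

/-- the profile `2D·K_prof` is nonnegative. [cite: Balaban1984PropagatorsII, Lemma 2.1 p.234, bookkeeping] -/
theorem Kp_nonneg {δ c16 : ℝ} (hc16 : 0 ≤ c16) (a : ℝ) (_ : 0 < a) :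
    0 ≤ 2 * ((d : ℝ) + 1) * Kprof (8 * δ) c16 (Fintype.card ↥(B6Geom246MultiLevelBoxL0.bset D.toDomains)) a := by
  unfold Kprof; split_ifs <;> positivity

/-- the (5.7)-rate of this file in closed form: `δ₄ = min(δ/4, (γ/A′)/(16D·c/δ + 1))` (the volume-dependent branch of `K_prof` is not met).
[cite: Balaban1983RegularityDecay, (5.7) p.594, bookkeeping] -/
theorem rate_eq (δ c16 γ A' : ℝ) :
    rate (fun a => 2 * ((d : ℝ) + 1) * Kprof (8 * δ) c16 (Fintype.card ↥(B6Geom246MultiLevelBoxL0.bset D.toDomains)) a) (γ / A') 1 δ =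
      min (δ / 4) (γ / A' / (2 * (1 * (4 / δ) * (2 * ((d : ℝ) + 1) * c16)) + 1)) := by
  unfold rate B4Sect5Torus.weightC Kprof
  simp only
  rw [if_pos (by linarith)]

/-- **[B6] PROPOSITION 2.7 (2.149) AT k LEVELS, FROM (2.142) AND THE LEVEL-WEIGHTED (2.147)** (the [3]-Sect.-5 road of p. 248–249): for a
torus family (`k ≥ 1`, `M_h ≥ 1`, `P′ ≥ 1`) with the Lemma-2.1 profile `Σ_{y′}e^{−(δ/2)d_T(y,y′)} ≤ c`, if the flat matrix of `QGQ*` obeys (2.142)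
`|X(i,i′)| ≤ A′(L^{j(i)}/c_f)²L^{−j(i′)D}e^{−δ d_T(β i, β i′)}` and `QGQ*` is coercive in the level-weighted form (2.147) `γΣ_iΛ_i²v_i² ≤ ⟪Q*v, GQ*v⟫`,
then for ALL index bonds `|⟪e_i, (QGQ*)⁻¹e_{i′}⟫| ≤ Λ_i⁻¹Λ_{i′}⁻¹·(2/γ)·e^{−δ₄ d_T(β i, β i′)}`, `δ₄ = rate(2D·K_prof, γ/A′, 1, δ)`,
`Λ_i⁻¹Λ_{i′}⁻¹ = c_f²·(L^{j(i)}L^{j(i′)})^{(D−2)/2}` (print: `O(1)(L^jη)^{d−2}η^{−2}e^{−δ₄d(b,b′)}`).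
[cite: Balaban1984PropagatorsII, Prop. 2.7 (2.149) p.249, (2.142) (2.147) p.248; Balaban1983RegularityDecay, Sect. 5 (5.6)–(5.7) p.594] -/
theorem prop27_kLevel_of_coercive (hMh : 1 ≤ Mh) (hP : ∀ μ, 1 ≤ P' μ)
    {A' δ γ c16 : ℝ} (hA : 0 < A') (hδ : 0 < δ) (hγ0 : 0 < γ) (hc16 : 0 ≤ c16)
    (h261 : Ineq261With c16 (geomT D) (8 * δ) (1 / 16))
    (h2142 : ∀ i i' : BondIdx (domT hN D hk), |X hN D hk hcf hw i i'| ≤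
      A' * ((((ℓ + 1 : ℕ) : ℝ)) ^ (lvl hN D hk i) / cf) ^ 2 * ((((ℓ + 1 : ℕ) : ℝ) ^ (d + 1)) ^ (lvl hN D hk i'))⁻¹ *
        Real.exp (-(δ * (geomT D).dist (β hN D hk i) (β hN D hk i'))))
    (hγ : ∀ v : BondIdxSpace (domT hN D hk), γ * ∑ i, wt hN D hk cf i * v i ^ 2 ≤
      ⟪QsE (domT hN D hk) v, GE (domT hN D hk) hcf hw (QsE (domT hN D hk) v)⟫_ℝ)
    (i i' : BondIdx (domT hN D hk)) :
    |⟪EuclideanSpace.single i (1 : ℝ), EE (domT hN D hk) hcf hw (EuclideanSpace.single i' (1 : ℝ))⟫_ℝ| ≤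
      (lam hN D hk cf i)⁻¹ * (lam hN D hk cf i')⁻¹ * (2 / γ *
        Real.exp (-(rate (fun a => 2 * ((d : ℝ) + 1) * Kprof (8 * δ) c16 (Fintype.card ↥(bset D.toDomains)) a) (γ / A') 1 δ *
          (geomT D).dist (β hN D hk i) (β hN D hk i')))) := by
  have hU := isUnit_Tc hN D hk hcf hw hγ0 hγ
  rw [inner_single_EE hN D hk hcf hw hU, abs_mul, abs_of_pos (mul_pos (inv_pos.2 (lam_pos hN D hk hcf i)) (inv_pos.2 (lam_pos hN D hk hcf i')))]
  refine mul_le_mul_of_nonneg_left ?_ (mul_pos (inv_pos.2 (lam_pos hN D hk hcf i)) (inv_pos.2 (lam_pos hN D hk hcf i'))).le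
  have hρ := rho_isPseudoDist hN D hk hMh hP
  have hS := rho_sumBound hN D hk (sumBound_torus D hMh hP h261)
  have hent := Tc_entry_le hN D hk hcf hw hA.le (ρ := rho hN D hk) (fun a b => hρ.symm a b) (fun a b => h2142 a b)
  exact inverse_entry_decay (Tc hN D hk hcf hw) (Tc_symm hN D hk hcf hw) hγ0 hA hδ (Tc_coercive hN D hk hcf hw hγ) hρ
    (Kp_nonneg D hc16) hS hent hU i i'

/-- **[B6] PROPOSITION 2.7 (2.149) AT k LEVELS FOR THE GENUINE `(QGQ*)⁻¹ = EE (domT hN D hk)`, MODULO THE LEVEL-WEIGHTED (2.147)**: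
(2.142) discharged by `B6Ineq2142KLevelV1L0.ineq2142_kLevel` (ROUTE V setting: `k ≥ 2`, `M_h = L^a ≥ 8`, `M₂ ≤ L·M_h`, `R ≥ 2L²`, `P′ ≥ 5`, `L ≥ 5`,
`Placed`, weights in the band (2.16)) and the profile of Lemma 2.1 discharged by `lemma21_torus` («for M large enough»: `N₁ + 1 ≤ R·L·M_h`):
there are `σ₁ > 0` and, for every `σ ∈ (0, σ₁]`, `α ∈ (0, 1)`, constants `A′ > 0`, `M₂ > 0`, `N₁`, `c ≥ 0` such that for every such torus,
EVERY `γ > 0` with `γΣ_iΛ_i²v_i² ≤ ⟪Q*v, GQ*v⟫` for all `v`, and ALL index bonds `i, i′`: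
`|⟪e_i, (QGQ*)⁻¹e_{i′}⟫| ≤ Λ_i⁻¹Λ_{i′}⁻¹·(2/γ)·e^{−δ₄ d_T(β i, β i′)}`, `δ₄ = min(δ₃/4, (γ/A′)/(16D·c/δ₃ + 1)) > 0`, `δ₃ = delta3 α (2σ)`.
[cite: Balaban1984PropagatorsII, Prop. 2.7 (2.149) p.249, (2.142)–(2.148) p.248; Balaban1983RegularityDecay, Sect. 5 (5.7) p.594] -/
theorem prop27_kLevel (d ℓ : ℕ) (hd : 1 ≤ d + 1) (hL : Odd (ℓ + 1) ∧ 1 < ℓ + 1) {b₀ b₁ : ℝ} (hb₀ : 0 < b₀) (hb₁ : b₀ ≤ b₁) :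
    ∃ σ₁ : ℝ, 0 < σ₁ ∧ ∀ (σ : ℝ), 0 < σ → σ ≤ σ₁ → ∀ (α : ℝ), 0 < α → α < 1 →
    ∃ (A' M₂ c : ℝ) (N₁ : ℕ), 0 < A' ∧ 0 < M₂ ∧ 0 ≤ c ∧
    ∀ (m K : ℕ) {Mh k R : ℕ} {P' : Fin (d + 1) → ℕ}
      (hN : ∀ μ, N0 ℓ Mh k P' μ = (PV d ℓ m K hd hL).sitesPerDir 0) (D : TDomains d ℓ Mh k P' R) (hk : k ≤ m + K) (_ : 2 ≤ k)
      {a : ℕ} (_ : Mh = (ℓ + 1) ^ a) (_ : 8 ≤ Mh) (_ : 2 * (ℓ + 1) ^ 2 ≤ R) (_ : ∀ μ, 5 ≤ P' μ) (_ : 4 ≤ ℓ)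
      (_ : ∀ c : ↥(cubes D.toDomains), Placed ℓ k P' c.1) (_ : M₂ ≤ ((ℓ : ℝ) + 1) * Mh) (_ : N₁ + 1 ≤ R * ((ℓ + 1) * Mh))
      {cf : ℝ} (hcf : cf ≠ 0) {w : BondIdx (domT hN D hk) → ℝ} (hw : ∀ i, 0 < w i) (_ : GlobalBand b₀ b₁ cf w)
      {γ : ℝ} (_ : 0 < γ)
      (_ : ∀ v : BondIdxSpace (domT hN D hk), γ * ∑ i, wt hN D hk cf i * v i ^ 2 ≤
        ⟪QsE (domT hN D hk) v, GE (domT hN D hk) hcf hw (QsE (domT hN D hk) v)⟫_ℝ),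
      ∀ i i' : BondIdx (domT hN D hk),
        |⟪EuclideanSpace.single i (1 : ℝ), EE (domT hN D hk) hcf hw (EuclideanSpace.single i' (1 : ℝ))⟫_ℝ| ≤
          (lam hN D hk cf i)⁻¹ * (lam hN D hk cf i')⁻¹ * (2 / γ *
            Real.exp (-(min (delta3 α (2 * σ) / 4) (γ / A' / (2 * (1 * (4 / delta3 α (2 * σ)) * (2 * ((d : ℝ) + 1) * c)) + 1)) *
              (geomT D).dist (β hN D hk i) (β hN D hk i')))) := by
  obtain ⟨σ₁, hσ₁, h⟩ := B6Ineq2142KLevelV1L0.ineq2142_kLevel d ℓ hd hL hb₀ hb₁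
  refine ⟨σ₁, hσ₁, fun σ hσ hσ1 α hα hα1 => ?_⟩
  obtain ⟨A₀, M₂, hA₀, hM₂, h2142⟩ := h σ hσ hσ1 α hα hα1.le
  -- a positive constant and the decay rate `δ₃ > 0` (`α < 1`)
  set A' : ℝ := A₀ + 1 with hA'
  have hA'0 : 0 < A' := by rw [hA']; linarith
  set δ : ℝ := delta3 α (2 * σ) with hδdef
  have hδ : 0 < δ := B6RandomWalk.delta3_pos hα1 (by linarith)
  -- the threshold of Lemma 2.1 on the torus at `α = 1/16`, `δ₀ = 8δ`
  have hL0 : (0 : ℝ) < (ℓ : ℝ) + 1 := by positivity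
  have hlog : Real.log ((ℓ : ℝ) + 1) ≤ (ℓ : ℝ) + 1 := (Real.log_le_sub_one_of_pos hL0).trans (by linarith)
  obtain ⟨N₁, hN₁⟩ : ∃ N₁ : ℕ, N₁ = ⌈4 * ((d : ℝ) + 1) * ((ℓ : ℝ) + 1) / δ⌉₊ + 1 := ⟨_, rfl⟩
  have hN₁pos : 0 < N₁ := by rw [hN₁]; omega
  have hN₁ge : 4 * ((d : ℝ) + 1) * ((ℓ : ℝ) + 1) < δ * (N₁ : ℝ) := by
    have h1 : 4 * ((d : ℝ) + 1) * ((ℓ : ℝ) + 1) / δ < (N₁ : ℝ) := by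
      rw [hN₁]; push_cast; exact lt_of_le_of_lt (Nat.le_ceil _) (by linarith)
    rw [div_lt_iff₀ hδ] at h1; linarith
  have hθ : Real.exp (-(1 / 16 * (8 * δ))) * ((ℓ : ℝ) + 1) ^ ((2 * (d + 1 : ℕ) : ℝ) / N₁) < 1 := by
    refine B6Ineq261LevelGap.theta_lt_one_of_log hL0 hN₁pos ?_
    push_cast
    have hd0 : (0 : ℝ) ≤ 2 * ((d : ℝ) + 1) := by positivity
    nlinarith [mul_le_mul_of_nonneg_left hlog hd0]
  set c16 : ℝ := K261 N₁ (d + 1) ((ℓ : ℝ) + 1) 1 (1 / 16 * (8 * δ)) with hc16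
  have hc16_0 : 0 ≤ c16 := K261_nonneg (by positivity) zero_le_one
  refine ⟨A', M₂, c16, N₁, hA'0, hM₂, hc16_0, ?_⟩
  intro m K Mh k R P' hN D hk hk2 a hMha hM8 hR2 hP5 hℓ hpl hM hRM cf hcf w hw hwb γ hγ0 hγ i i'
  have hMh : 1 ≤ Mh := le_trans (by norm_num) hM8
  have hP : ∀ μ, 1 ≤ P' μ := fun μ => le_trans (by norm_num) (hP5 μ)
  -- (2.142) with the constant `A′ = A₀ + 1 > 0`
  have h2142' : ∀ i i' : BondIdx (domT hN D hk), |X hN D hk hcf hw i i'| ≤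
      A' * ((((ℓ + 1 : ℕ) : ℝ)) ^ (lvl hN D hk i) / cf) ^ 2 * ((((ℓ + 1 : ℕ) : ℝ) ^ (d + 1)) ^ (lvl hN D hk i'))⁻¹ *
        Real.exp (-(δ * (geomT D).dist (β hN D hk i) (β hN D hk i'))) := fun i i' =>
    (h2142 m K hN D hk hk2 hMha hM8 hR2 hP5 hℓ hpl hM hcf hw hwb i i').trans (by
      apply mul_le_mul_of_nonneg_right _ (Real.exp_pos _).le
      apply mul_le_mul_of_nonneg_right _ (by positivity)
      apply mul_le_mul_of_nonneg_right _ (sq_nonneg _)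
      rw [hA']; linarith)
  -- Lemma 2.1 on the torus
  obtain ⟨-, h261, -, -⟩ := lemma21_torus D hMh hP hN₁pos hRM (δ₀ := 8 * δ) (α := 1 / 16) (by linarith) (by norm_num) (by norm_num) hθ
  have h := prop27_kLevel_of_coercive hN D hk hcf hw hMh hP hA'0 hδ hγ0 hc16_0 h261 h2142' hγ i i'
  rwa [rate_eq D] at h

end Main

end

end Literature.MathematicalPhysics.QuantumFieldTheory.Balaban1983to89.B6Prop27KLevelV1L0
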